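import Literature.Geometry.Lorentzian.CoordMetricVariation
import Literature.Geometry.Lorentzian.CoordRicciCovariance
import Literature.Geometry.Lorentzian.CoordCurvatureCubicTrace
import HarnessLib

/-!
# Killing vector fields preserve the scalar curvature invariants (coordinate tensor calculus)

Infrastructure (everything proved; no definition, no named fact) for the classification of the
Killing fields of the Kerr metric (O'Neill, *The geometry of Kerr black holes* (1995), Ch. 3,
Cor. 3.7.4, named fact `Literature.Geometry.Lorentzian.ONeill1995_kerrKillingFields`), whose
printed proof starts from "the functions `r` and `C² = cos²ϑ` … are isometric invariants" — they are
read off the Weyl curvature scalars, which every (local) isometry, hence the local flow of every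
Killing field, preserves (O'Neill 1983, Ch. 3, Prop. 3.59–Cor. 3.61; Ch. 9, Prop. 9.23). Mathlib
has no differentiable dependence of flows on initial conditions, so the INFINITESIMAL statement is
proved here directly, in the coordinate tensor calculus of `CoordCurvature.lean`
(`MetricCoord.IsMetricOn G V`: metric components on an open set `V` of a finite-dimensional real
normed space `E`):

* `IsMetricFamilyOn.hasDerivWithinAt_rmNormSqAt_zero`, `….hasDerivWithinAt_cubicTrace_zero` — for a
  smooth one-parameter family of metric components (`CoordMetricVariation.lean`) whose first
  variation `h_t = ∂G/∂t` vanishes identically on `V` at time `t`, the square norm of the curvature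
  `|Rm|²` (`rmNormSqAt`) and the cubic trace invariant
  `Σ g^{aa'} g^{cc'} g^{ee'} tr(R(b_a,b_c) R(b_{c'},b_e) R(b_{e'},b_{a'}))` are stationary at `t`
  (Topping 2006, Prop. 2.3.1 and 2.3.4: `∂_t Γ = Π(h, ∇h) = 0`, `∂_t R = 0`, `∂_t g⁻¹ = −g⁻¹ h g⁻¹ = 0`);
* `exists_isCoordChangeOn_shift` — for a `C^∞` vector field `X` on `V` and `x ∈ V`, the maps
  `ψ_t = id + tX`, `|t| ≤ ε`, are changes of coordinates `ball x ρ → V` (`IsCoordChangeOn`);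
* `hasDerivAt_pullMetric_shift` — the first variation of `t ↦ ψ_t^* G` at `t = 0` is the Lie
  derivative `𝓛_X G = DG(X)(·,·) + G(DX·,·) + G(·,DX·)`, so it vanishes when `X` satisfies the
  coordinate Killing equation `𝓛_X G = 0` (O'Neill 1983, Ch. 9, Prop. 9.23–9.25);
  `exists_isMetricFamilyOn_shift` packages the resulting smooth family (`IsMetricFamilyOn`);
* **`fderiv_rmNormSqAt_apply_eq_zero`, `fderiv_cubicTrace_apply_eq_zero`** — if `𝓛_X G = 0` on `V`
  then `X(|Rm|²_G) = 0` and `X(cubic trace) = 0` on `V`: by naturality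
  (`rmNormSqAt_pullMetric`, `cubicTrace_pullMetric`, `cubicTrace_eq_of_basis`;
  `CoordRicciCovariance.lean`) `Q(ψ_t^*G)(x) = Q(G)(ψ_t x)`, the left-hand side is stationary at
  `t = 0`, and the derivative of the right-hand side is `DQ_x(X x)`.

## References

* B. O'Neill, *Semi-Riemannian geometry with applications to relativity*, Academic Press 1983,
  Ch. 3, Prop. 3.59–Cor. 3.61 (isometries preserve curvature); Ch. 9, Def. 9.21–Prop. 9.25 (Killing
  fields, `𝓛_X g = 0`, local flows by isometries). [ONeill1983]
* B. O'Neill, *The geometry of Kerr black holes*, A K Peters 1995, Ch. 3, §3.7 (p. 133: "`r` and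
  `C²` are isometric invariants"), Cor. 3.7.4. [ONeill1995]
* P. Topping, *Lectures on the Ricci flow*, CUP 2006, Prop. 2.3.1, Prop. 2.3.4. [Topping2006]
-/

noncomputable section

set_option maxSynthPendingDepth 3

open Set Filter ContinuousLinearMap Module Function Metric
open scoped Topology ContDiff

namespace Literature.Geometry.Lorentzian

namespace MetricCoord

variable {E : Type*} [NormedAddCommGroup E] [NormedSpace ℝ E] [CompleteSpace E]

/-! ### A family of metric components with vanishing first variation -/

namespace IsMetricFamilyOn

variable {𝒢 : ℝ → E → E →L[ℝ] E →L[ℝ] ℝ} {S : Set ℝ} {V : Set E} {x : E} {t : ℝ}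

omit [CompleteSpace E] in
/-- If the first variation `h_t = ∂G/∂t` vanishes identically on `V`, so does its `x`-derivative.
[folklore] -/
theorem fderiv_tDeriv_eq_zero (h𝒢 : IsMetricFamilyOn 𝒢 S V) (ht : t ∈ S)
    (h0 : ∀ y ∈ V, tDeriv 𝒢 S t y = 0) (hx : x ∈ V) : fderiv ℝ (tDeriv 𝒢 S t) x = 0 := by
  have heq : tDeriv 𝒢 S t =ᶠ[𝓝 x] fun _ ↦ (0 : E →L[ℝ] E →L[ℝ] ℝ) :=
    Filter.eventually_of_mem ((h𝒢.isOpen ht).mem_nhds hx) fun y hy ↦ h0 y hy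
  rw [heq.fderiv_eq, fderiv_fun_const]
  rfl

/-- If `h_t ≡ 0` on `V` then the variation of the Christoffel map vanishes on `V`:
`Π_t = 0`. [cite: Topping2006, Prop. 2.3.1] -/
theorem varChrAt_eq_zero (h𝒢 : IsMetricFamilyOn 𝒢 S V) (ht : t ∈ S)
    (h0 : ∀ y ∈ V, tDeriv 𝒢 S t y = 0) (hx : x ∈ V) : varChrAt 𝒢 S t x = 0 := by
  ext X Y
  rw [varChrAt_apply, h0 x hx, h𝒢.fderiv_tDeriv_eq_zero ht h0 hx]
  simp

/-- If `h_t ≡ 0` on `V` then `D_x Π_t = 0` on `V`. [folklore] -/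
theorem fderiv_varChrAt_eq_zero (h𝒢 : IsMetricFamilyOn 𝒢 S V) (ht : t ∈ S)
    (h0 : ∀ y ∈ V, tDeriv 𝒢 S t y = 0) (hx : x ∈ V) : fderiv ℝ (varChrAt 𝒢 S t) x = 0 := by
  have heq : varChrAt 𝒢 S t =ᶠ[𝓝 x] fun _ ↦ (0 : E →L[ℝ] E →L[ℝ] E) :=
    Filter.eventually_of_mem ((h𝒢.isOpen ht).mem_nhds hx) fun y hy ↦
      h𝒢.varChrAt_eq_zero ht h0 hy
  rw [heq.fderiv_eq, fderiv_fun_const]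
  rfl

/-- If `h_t ≡ 0` on `V` then the variation of the curvature endomorphism vanishes:
`∂_t R(X,Y) = 0`. [cite: Topping2006, Prop. 2.3.4] -/
theorem varRiemAt_eq_zero (h𝒢 : IsMetricFamilyOn 𝒢 S V) (ht : t ∈ S)
    (h0 : ∀ y ∈ V, tDeriv 𝒢 S t y = 0) (hx : x ∈ V) (X Y : E) : varRiemAt 𝒢 S t x X Y = 0 := by
  simp only [varRiemAt, h𝒢.varChrAt_eq_zero ht h0 hx, h𝒢.fderiv_varChrAt_eq_zero ht h0 hx]
  simp

/-- If `h_t ≡ 0` on `V` then `s ↦ R_s(X,Y)Z` has derivative `0` at `t` within `S`. [cite: Topping2006, Prop. 2.3.4] -/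
theorem hasDerivWithinAt_riemAt_apply_zero (h𝒢 : IsMetricFamilyOn 𝒢 S V) (ht : t ∈ S)
    (h0 : ∀ y ∈ V, tDeriv 𝒢 S t y = 0) (hx : x ∈ V) (X Y Z : E) :
    HasDerivWithinAt (fun s ↦ riemAt (𝒢 s) x X Y Z) 0 S t := by
  have h := h𝒢.hasDerivWithinAt_riemAt_apply hx ht X Y Z
  rwa [h𝒢.varRiemAt_eq_zero ht h0 hx, zero_apply] at h

/-- If `h_t ≡ 0` on `V` then `s ↦ R_s(X,Y)` has derivative `0` at `t` within `S`. [cite: Topping2006, Prop. 2.3.4] -/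
theorem hasDerivWithinAt_riemAt_zero (h𝒢 : IsMetricFamilyOn 𝒢 S V) (ht : t ∈ S)
    (h0 : ∀ y ∈ V, tDeriv 𝒢 S t y = 0) (hx : x ∈ V) (X Y : E) :
    HasDerivWithinAt (fun s ↦ riemAt (𝒢 s) x X Y) 0 S t := by
  have h := h𝒢.hasDerivWithinAt_riemAt hx ht X Y
  rwa [h𝒢.varRiemAt_eq_zero ht h0 hx] at h

/-- If `h_t(x) = 0` then `s ↦ ♯_s` has derivative `0` at `t` within `S`. [cite: Topping2006, §2.3.2] -/
theorem hasDerivWithinAt_sharpAt_zero (h𝒢 : IsMetricFamilyOn 𝒢 S V) (ht : t ∈ S)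
    (h0 : tDeriv 𝒢 S t x = 0) (hx : x ∈ V) :
    HasDerivWithinAt (fun s ↦ sharpAt (𝒢 s) x) 0 S t := by
  have h := h𝒢.hasDerivWithinAt_sharpAt hx ht
  rwa [h0, ContinuousLinearMap.zero_comp, ContinuousLinearMap.comp_zero, neg_zero] at h

variable [FiniteDimensional ℝ E]

/-- If `h_t(x) = 0` then the inverse metric coefficients `s ↦ g_s^{ij}(x)` have derivative `0` at
`t` within `S`. [cite: Topping2006, §2.3.2] -/
theorem hasDerivWithinAt_ginv_zero {ι : Type*} [Fintype ι] (b : Basis ι ℝ E)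
    (h𝒢 : IsMetricFamilyOn 𝒢 S V) (ht : t ∈ S) (h0 : tDeriv 𝒢 S t x = 0) (hx : x ∈ V) (i j : ι) :
    HasDerivWithinAt (fun s ↦ ginv (𝒢 s) b x i j) 0 S t := by
  have h1 := (h𝒢.hasDerivWithinAt_sharpAt_zero ht h0 hx).clm_apply
    (hasDerivWithinAt_const t S (coordCLM b j))
  simp only [zero_apply, zero_add, map_zero] at h1
  have h2 := (coordCLM b i).hasFDerivAt.comp_hasDerivWithinAt t h1
  simp only [map_zero] at h2
  exact h2

/-- **If the first variation vanishes on `V`, the square norm of the curvature is stationary**: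
`s ↦ |Rm|²_{G_s}(x)` has derivative `0` at `t` within `S`. [cite: Topping2006, Prop. 2.3.4] -/
theorem hasDerivWithinAt_rmNormSqAt_zero (h𝒢 : IsMetricFamilyOn 𝒢 S V) (ht : t ∈ S)
    (h0 : ∀ y ∈ V, tDeriv 𝒢 S t y = 0) (hx : x ∈ V) :
    HasDerivWithinAt (fun s ↦ rmNormSqAt (𝒢 s) x) 0 S t := by
  set b := Module.finBasis ℝ E with hb
  have hfun : (fun s ↦ rmNormSqAt (𝒢 s) x) = fun s ↦
      -∑ a, ∑ a', ∑ c, ∑ c', ginv (𝒢 s) b x a a' * ginv (𝒢 s) b x c c' *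
        traceCLM E ((riemAt (𝒢 s) x (b a) (b c)).comp (riemAt (𝒢 s) x (b a') (b c'))) :=
    funext fun s ↦ rmNormSqAt_eq_sum b
  rw [hfun]
  have hg := h𝒢.hasDerivWithinAt_ginv_zero b ht (h0 x hx) hx
  have hR := h𝒢.hasDerivWithinAt_riemAt_zero ht h0 hx
  have hterm : ∀ a a' c c', HasDerivWithinAt (fun s ↦ ginv (𝒢 s) b x a a' * ginv (𝒢 s) b x c c' *
      traceCLM E ((riemAt (𝒢 s) x (b a) (b c)).comp (riemAt (𝒢 s) x (b a') (b c')))) 0 S t := by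
    intro a a' c c'
    have hcomp := (hR (b a) (b c)).clm_comp (hR (b a') (b c'))
    simp only [ContinuousLinearMap.zero_comp, ContinuousLinearMap.comp_zero, add_zero] at hcomp
    have htr : HasDerivWithinAt (fun s ↦ traceCLM E ((riemAt (𝒢 s) x (b a) (b c)).comp
        (riemAt (𝒢 s) x (b a') (b c')))) 0 S t := by
      have := (traceCLM E).hasFDerivAt.comp_hasDerivWithinAt t hcomp
      simpa [Function.comp_def] using this
    have h := ((hg a a').fun_mul (hg c c')).fun_mul htr
    simpa using h
  have hsum := HasDerivWithinAt.fun_sum (u := Finset.univ) fun a _ ↦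
    HasDerivWithinAt.fun_sum (u := Finset.univ) fun a' _ ↦
      HasDerivWithinAt.fun_sum (u := Finset.univ) fun c _ ↦
        HasDerivWithinAt.fun_sum (u := Finset.univ) fun c' _ ↦ hterm a a' c c'
  simp only [Finset.sum_const_zero] at hsum
  simpa using hsum.fun_neg

/-- **If the first variation vanishes on `V`, the cubic trace invariant is stationary**:
`s ↦ Σ g_s^{aa'} g_s^{cc'} g_s^{ee'} tr(R_s(b_a,b_c) R_s(b_{c'},b_e) R_s(b_{e'},b_{a'}))(x)` has
derivative `0` at `t` within `S`, in any basis `b`. [cite: Topping2006, Prop. 2.3.4] -/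
theorem hasDerivWithinAt_cubicTrace_zero {ι : Type*} [Fintype ι] (b : Basis ι ℝ E)
    (h𝒢 : IsMetricFamilyOn 𝒢 S V) (ht : t ∈ S) (h0 : ∀ y ∈ V, tDeriv 𝒢 S t y = 0) (hx : x ∈ V) :
    HasDerivWithinAt (fun s ↦ ∑ a, ∑ a', ∑ c, ∑ c', ∑ e, ∑ e',
        ginv (𝒢 s) b x a a' * ginv (𝒢 s) b x c c' * ginv (𝒢 s) b x e e' *
        traceCLM E ((riemAt (𝒢 s) x (b a) (b c)).comp
          ((riemAt (𝒢 s) x (b c') (b e)).comp (riemAt (𝒢 s) x (b e') (b a'))))) 0 S t := by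
  have hg := h𝒢.hasDerivWithinAt_ginv_zero b ht (h0 x hx) hx
  have hR := h𝒢.hasDerivWithinAt_riemAt_zero ht h0 hx
  have hterm : ∀ a a' c c' e e', HasDerivWithinAt (fun s ↦
      ginv (𝒢 s) b x a a' * ginv (𝒢 s) b x c c' * ginv (𝒢 s) b x e e' *
        traceCLM E ((riemAt (𝒢 s) x (b a) (b c)).comp
          ((riemAt (𝒢 s) x (b c') (b e)).comp (riemAt (𝒢 s) x (b e') (b a'))))) 0 S t := by
    intro a a' c c' e e'
    have hcomp := (hR (b a) (b c)).clm_comp ((hR (b c') (b e)).clm_comp (hR (b e') (b a')))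
    simp only [ContinuousLinearMap.zero_comp, ContinuousLinearMap.comp_zero, add_zero] at hcomp
    have htr : HasDerivWithinAt (fun s ↦ traceCLM E ((riemAt (𝒢 s) x (b a) (b c)).comp
        ((riemAt (𝒢 s) x (b c') (b e)).comp (riemAt (𝒢 s) x (b e') (b a'))))) 0 S t := by
      have := (traceCLM E).hasFDerivAt.comp_hasDerivWithinAt t hcomp
      simpa [Function.comp_def] using this
    have h := (((hg a a').fun_mul (hg c c')).fun_mul (hg e e')).fun_mul htr
    simpa using h
  have hsum := HasDerivWithinAt.fun_sum (u := Finset.univ) fun a _ ↦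
    HasDerivWithinAt.fun_sum (u := Finset.univ) fun a' _ ↦
      HasDerivWithinAt.fun_sum (u := Finset.univ) fun c _ ↦
        HasDerivWithinAt.fun_sum (u := Finset.univ) fun c' _ ↦
          HasDerivWithinAt.fun_sum (u := Finset.univ) fun e _ ↦
            HasDerivWithinAt.fun_sum (u := Finset.univ) fun e' _ ↦ hterm a a' c c' e e'
  simp only [Finset.sum_const_zero] at hsum
  exact hsum

end IsMetricFamilyOn

/-! ### The one-parameter family of coordinate changes `ψ_t = id + t X` -/

section Shift

variable [FiniteDimensional ℝ E] {G : E → E →L[ℝ] E →L[ℝ] ℝ} {V : Set E} {X : E → E} {x : E}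

omit [CompleteSpace E] in
/-- An injective continuous linear endomorphism of a finite-dimensional space is invertible.
[folklore] -/
private theorem isInvertible_of_injective' {f : E →L[ℝ] E} (hf : Injective f) : f.IsInvertible := by
  refine ⟨(LinearEquiv.ofInjectiveEndo (f : E →ₗ[ℝ] E) hf).toContinuousLinearEquiv, ?_⟩
  ext v
  rfl

omit [FiniteDimensional ℝ E] [CompleteSpace E] in
/-- `id + A` is injective when `‖A‖ ≤ 1/2`. [folklore] -/
private theorem injective_id_add {A : E →L[ℝ] E} (hA : ‖A‖ ≤ 2⁻¹) :
    Injective (ContinuousLinearMap.id ℝ E + A) := by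
  intro v w hvw
  have h1 : v + A v = w + A w := by simpa using hvw
  have h : v - w = -(A (v - w)) := by
    rw [map_sub, neg_sub, sub_eq_sub_iff_add_eq_add, add_comm (A w) w]
    exact h1
  have hn : ‖v - w‖ ≤ 2⁻¹ * ‖v - w‖ := by
    have h2 : ‖v - w‖ = ‖A (v - w)‖ := by
      have := congrArg (‖·‖) h
      simpa only [norm_neg] using this
    calc ‖v - w‖ = ‖A (v - w)‖ := h2
      _ ≤ ‖A‖ * ‖v - w‖ := A.le_opNorm _
      _ ≤ 2⁻¹ * ‖v - w‖ := by gcongr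
  have h0 : ‖v - w‖ = 0 := by nlinarith [norm_nonneg (v - w)]
  rw [norm_eq_zero, sub_eq_zero] at h0
  exact h0

omit [FiniteDimensional ℝ E] [CompleteSpace E] in
/-- The derivative of `ψ_t = id + t X` at a point where `X` is differentiable. [folklore] -/
theorem hasFDerivAt_shift (hX : DifferentiableAt ℝ X x) (t : ℝ) :
    HasFDerivAt (fun y ↦ y + t • X y) (ContinuousLinearMap.id ℝ E + t • fderiv ℝ X x) x :=
  (hasFDerivAt_id x).add (hX.hasFDerivAt.const_smul t)

omit [FiniteDimensional ℝ E] [CompleteSpace E] in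
/-- `Dψ_t = id + t DX`. [folklore] -/
theorem fderiv_shift (hX : DifferentiableAt ℝ X x) (t : ℝ) :
    fderiv ℝ (fun y ↦ y + t • X y) x = ContinuousLinearMap.id ℝ E + t • fderiv ℝ X x :=
  (hasFDerivAt_shift hX t).fderiv

omit [CompleteSpace E] in
/-- **The maps `ψ_t = id + t X` are changes of coordinates near any point, for small `t`.** For a
vector field `X` of class `C^∞` on the open set `V` and `x ∈ V` there are `ρ, ε > 0` with
`ball x ρ ⊆ V` such that for `|t| ≤ ε` the map `ψ_t` is `C^∞` on `ball x ρ`, maps it into `V` and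
has invertible derivative there (`MetricCoord.IsCoordChangeOn`). [folklore] -/
theorem exists_isCoordChangeOn_shift (hV : IsOpen V) (hX : ContDiffOn ℝ ∞ X V) (hx : x ∈ V) :
    ∃ ρ ε : ℝ, 0 < ρ ∧ 0 < ε ∧ ball x ρ ⊆ V ∧
      ∀ t ∈ Icc (-ε) ε, IsCoordChangeOn (fun y ↦ y + t • X y) (ball x ρ) V := by
  -- a closed ball inside `V`
  obtain ⟨R, hR, hRV⟩ := Metric.isOpen_iff.1 hV x hx
  have hK : IsCompact (closedBall x (R / 2)) := isCompact_closedBall x (R / 2)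
  have hKV : closedBall x (R / 2) ⊆ V := (closedBall_subset_ball (by linarith)).trans hRV
  -- bounds for `X` and `DX` on it
  have hXc : ContinuousOn X (closedBall x (R / 2)) := hX.continuousOn.mono hKV
  obtain ⟨B, hB⟩ := hK.exists_bound_of_continuousOn hXc
  have hDXc : ContinuousOn (fderiv ℝ X) (closedBall x (R / 2)) :=
    (hX.continuousOn_fderiv_of_isOpen hV (by simp)).mono hKV
  obtain ⟨B', hB'⟩ := hK.exists_bound_of_continuousOn hDXc
  have hB0 : 0 ≤ B := (norm_nonneg _).trans (hB x (mem_closedBall_self (by linarith)))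
  have hB'0 : 0 ≤ B' := (norm_nonneg _).trans (hB' x (mem_closedBall_self (by linarith)))
  set ρ : ℝ := R / 4 with hρ
  set ε : ℝ := min (ρ / (B + 1)) (2⁻¹ / (B' + 1)) with hε
  have hρ0 : 0 < ρ := by rw [hρ]; linarith
  have hε0 : 0 < ε := lt_min (by positivity) (by positivity)
  have hballV : ball x ρ ⊆ V := (ball_subset_ball (by rw [hρ]; linarith)).trans hRV
  have hballK : ball x ρ ⊆ closedBall x (R / 2) :=
    (ball_subset_closedBall).trans (closedBall_subset_closedBall (by rw [hρ]; linarith))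
  refine ⟨ρ, ε, hρ0, hε0, hballV, fun t ht ↦ ?_⟩
  have htε : |t| ≤ ε := abs_le.2 ⟨ht.1, ht.2⟩
  have htB : |t| * B ≤ ρ := by
    have h1 : |t| * B ≤ ε * B := by gcongr
    have h2 : ε * B ≤ ρ / (B + 1) * B := by gcongr; exact min_le_left _ _
    have h3 : ρ / (B + 1) * B ≤ ρ := by
      rw [div_mul_eq_mul_div, div_le_iff₀ (by positivity)]
      nlinarith
    linarith
  have htB' : |t| * B' ≤ 2⁻¹ := by
    have h1 : |t| * B' ≤ ε * B' := by gcongr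
    have h2 : ε * B' ≤ 2⁻¹ / (B' + 1) * B' := by gcongr; exact min_le_right _ _
    have h3 : 2⁻¹ / (B' + 1) * B' ≤ 2⁻¹ := by
      rw [div_mul_eq_mul_div, div_le_iff₀ (by positivity)]
      nlinarith
    linarith
  refine ⟨isOpen_ball, ?_, fun y hy ↦ ?_, fun y hy ↦ ?_⟩
  · exact contDiffOn_id.add ((hX.mono hballV).const_smul t)
  · -- `ψ_t y ∈ ball x (R/2 + ρ) ⊆ ball x R ⊆ V`
    apply hRV
    rw [mem_ball, dist_eq_norm]
    have hy' : ‖y - x‖ < ρ := by rwa [mem_ball, dist_eq_norm] at hy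
    have hXy : ‖X y‖ ≤ B := hB y (hballK hy)
    calc ‖y + t • X y - x‖ = ‖(y - x) + t • X y‖ := by abel_nf
      _ ≤ ‖y - x‖ + ‖t • X y‖ := norm_add_le _ _
      _ = ‖y - x‖ + |t| * ‖X y‖ := by rw [norm_smul, Real.norm_eq_abs]
      _ ≤ ‖y - x‖ + |t| * B := by gcongr
      _ < ρ + ρ := by linarith
      _ ≤ R := by rw [hρ]; linarith
  · -- `Dψ_t = id + t DX` is injective, hence invertible
    have hXd : DifferentiableAt ℝ X y :=
      (hX.differentiableOn (by simp)).differentiableAt (hV.mem_nhds (hballV hy))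
    rw [fderiv_shift hXd t]
    refine isInvertible_of_injective' (injective_id_add ?_)
    calc ‖t • fderiv ℝ X y‖ = |t| * ‖fderiv ℝ X y‖ := by rw [norm_smul, Real.norm_eq_abs]
      _ ≤ |t| * B' := by gcongr; exact hB' y (hballK hy)
      _ ≤ 2⁻¹ := htB'

end Shift

/-! ### The pulled-back family `ψ_t^* G` and its first variation `𝓛_X G` -/

section Family

variable [FiniteDimensional ℝ E] {G : E → E →L[ℝ] E →L[ℝ] ℝ} {V V' : Set E} {S : Set ℝ}
  {X : E → E} {x y : E}

omit [FiniteDimensional ℝ E] [CompleteSpace E] in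
/-- **Joint smoothness of the pulled-back family** `(y, t) ↦ (ψ_t^* G)(y)` on `V' × S`, when every
`ψ_t = id + t X`, `t ∈ S`, maps `V' ⊆ V` into `V`. [folklore] -/
theorem contDiffOn_pullMetric_shift (hG : IsMetricOn G V) (hX : ContDiffOn ℝ ∞ X V) (hV' : V' ⊆ V)
    (hmaps : ∀ t ∈ S, MapsTo (fun y ↦ y + t • X y) V' V) :
    ContDiffOn ℝ ∞ (fun p : E × ℝ ↦ pullMetric G (fun y ↦ y + p.2 • X y) p.1) (V' ×ˢ S) := by
  have hfst : ContDiffOn ℝ ∞ (fun p : E × ℝ ↦ p.1) (V' ×ˢ S) := contDiffOn_fst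
  have hsnd : ContDiffOn ℝ ∞ (fun p : E × ℝ ↦ p.2) (V' ×ˢ S) := contDiffOn_snd
  have hm1 : MapsTo (fun p : E × ℝ ↦ p.1) (V' ×ˢ S) V := fun p hp ↦ hV' hp.1
  have hXp : ContDiffOn ℝ ∞ (fun p : E × ℝ ↦ X p.1) (V' ×ˢ S) := hX.comp hfst hm1
  have hψ : ContDiffOn ℝ ∞ (fun p : E × ℝ ↦ p.1 + p.2 • X p.1) (V' ×ˢ S) := hfst.add (hsnd.smul hXp)
  have hm2 : MapsTo (fun p : E × ℝ ↦ p.1 + p.2 • X p.1) (V' ×ˢ S) V := fun p hp ↦ hmaps p.2 hp.2 hp.1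
  have hGψ : ContDiffOn ℝ ∞ (fun p : E × ℝ ↦ G (p.1 + p.2 • X p.1)) (V' ×ˢ S) := hG.contDiffOn.comp hψ hm2
  have hDX : ContDiffOn ℝ ∞ (fun p : E × ℝ ↦ fderiv ℝ X p.1) (V' ×ˢ S) :=
    (hX.fderiv_of_isOpen hG.isOpen (by simp)).comp hfst hm1
  have hD : ContDiffOn ℝ ∞ (fun p : E × ℝ ↦ ContinuousLinearMap.id ℝ E + p.2 • fderiv ℝ X p.1)
      (V' ×ˢ S) := contDiffOn_const.add (hsnd.smul hDX)
  have h1 := hGψ.clm_comp hD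
  have h2 := flipCLM.contDiff.comp_contDiffOn h1
  have h3 := flipCLM.contDiff.comp_contDiffOn (h2.clm_comp hD)
  refine h3.congr fun p hp ↦ ?_
  have hXd : DifferentiableAt ℝ X p.1 :=
    (hX.differentiableOn (by simp)).differentiableAt (hG.isOpen.mem_nhds (hV' hp.1))
  rw [pullMetric_eq_flip, fderiv_shift hXd]
  rfl

omit [FiniteDimensional ℝ E] [CompleteSpace E] in
/-- **The first variation of `ψ_t^* G` at `t = 0` is the Lie derivative `𝓛_X G`**: at a point `y`
of `V` where `𝓛_X G (y) = DG_y(X)(·,·) + G_y(DX ·, ·) + G_y(·, DX ·)` vanishes, `s ↦ (ψ_s^* G)(y)`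
has derivative `0` at `s = 0`. O'Neill 1983, Ch. 9, Prop. 9.23–9.25 (`𝓛_X g` as the derivative
of the pulled-back metrics). [cite: ONeill1983, Ch. 9, Prop. 9.23] -/
theorem hasDerivAt_pullMetric_shift (hG : IsMetricOn G V) (hX : ContDiffOn ℝ ∞ X V) (hy : y ∈ V)
    (hLG : ∀ v w, fderiv ℝ G y (X y) v w + G y (fderiv ℝ X y v) w + G y v (fderiv ℝ X y w) = 0) :
    HasDerivAt (fun s : ℝ ↦ pullMetric G (fun z ↦ z + s • X z) y) 0 0 := by
  have hXd : DifferentiableAt ℝ X y :=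
    (hX.differentiableOn (by simp)).differentiableAt (hG.isOpen.mem_nhds hy)
  set A := fderiv ℝ X y with hA
  have hfun : (fun s : ℝ ↦ pullMetric G (fun z ↦ z + s • X z) y) = fun s : ℝ ↦
      flipCLM ((flipCLM ((G (y + s • X y)).comp (ContinuousLinearMap.id ℝ E + s • A))).comp
        (ContinuousLinearMap.id ℝ E + s • A)) := by
    funext s
    rw [pullMetric_eq_flip, fderiv_shift hXd s]
  rw [hfun]
  -- the factors
  have hin : HasDerivAt (fun s : ℝ ↦ y + s • X y) (X y) 0 := by
    simpa using ((hasDerivAt_id (0 : ℝ)).smul_const (X y)).const_add y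
  have hGd : HasFDerivAt G (fderiv ℝ G y) (y + (0 : ℝ) • X y) := by
    rw [zero_smul, add_zero]; exact (hG.differentiableAt hy).hasFDerivAt
  have hB : HasDerivAt (fun s : ℝ ↦ G (y + s • X y)) (fderiv ℝ G y (X y)) 0 :=
    hGd.comp_hasDerivAt (0 : ℝ) hin
  have hD : HasDerivAt (fun s : ℝ ↦ ContinuousLinearMap.id ℝ E + s • A) A 0 := by
    simpa using ((hasDerivAt_id (0 : ℝ)).smul_const A).const_add (ContinuousLinearMap.id ℝ E)
  have h1 := hB.clm_comp hD
  have h2 := flipCLM.hasFDerivAt.comp_hasDerivAt (0 : ℝ) h1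
  have h3 := h2.clm_comp hD
  have h4 := flipCLM.hasFDerivAt.comp_hasDerivAt (0 : ℝ) h3
  simp only [zero_smul, add_zero, Function.comp_def] at h4
  refine h4.congr_deriv ?_
  ext v w
  simp only [zero_apply, map_add, flipCLM_apply, _root_.add_apply,
    ContinuousLinearMap.flip_apply, ContinuousLinearMap.comp_apply, ContinuousLinearMap.id_apply]
  linarith [hLG v w]

/-! ### Killing vector fields preserve the scalar curvature invariants -/

omit [CompleteSpace E] in
/-- The cubic trace sum (fixed basis) is `C^∞` on `V` for metric components on `V` (a polynomial in
`g⁻¹` and the components of `R`). [folklore] -/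
private theorem contDiffOn_cubicTrace' {κ : Type*} [Fintype κ] (e : Basis κ ℝ E)
    (hG : IsMetricOn G V) :
    ContDiffOn ℝ ∞ (fun y ↦ ∑ i, ∑ i', ∑ j, ∑ j', ∑ k, ∑ k',
      ginv G e y i i' * ginv G e y j j' * ginv G e y k k' *
        traceCLM E ((riemAt G y (e i) (e j)).comp
          ((riemAt G y (e j') (e k)).comp (riemAt G y (e k') (e i'))))) V := by
  refine ContDiffOn.sum fun i _ ↦ ContDiffOn.sum fun i' _ ↦ ContDiffOn.sum fun j _ ↦
    ContDiffOn.sum fun j' _ ↦ ContDiffOn.sum fun k _ ↦ ContDiffOn.sum fun k' _ ↦ ?_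
  exact (((hG.contDiffOn_ginv e i i').mul (hG.contDiffOn_ginv e j j')).mul
    (hG.contDiffOn_ginv e k k')).mul ((traceCLM E).contDiff.comp_contDiffOn
      ((hG.contDiffOn_riemAt (e i) (e j)).clm_comp
        ((hG.contDiffOn_riemAt (e j') (e k)).clm_comp (hG.contDiffOn_riemAt (e k') (e i')))))

omit [CompleteSpace E] in
/-- **The shifts of an infinitesimal isometry form a smooth metric family with vanishing first
variation.** For metric components `G` on `V` and a `C^∞` vector field `X` on `V` satisfying the
coordinate Killing equation `𝓛_X G = 0`, i.e. `DG_y(X y)(v,w) + G_y(DX_y v, w) + G_y(v, DX_y w) = 0`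
on `V` (O'Neill 1983, Ch. 9, Prop. 9.25: `X` is Killing iff `𝓛_X g = 0`), around every `x ∈ V`
there are `ρ, ε > 0` such that `t ↦ ψ_t^* G`, `ψ_t = id + tX`, `|t| ≤ ε`, is a smooth family of
metric components on `ball x ρ ⊆ V` by changes of coordinates into `V`, whose first variation
vanishes at `t = 0` on the whole ball. [cite: ONeill1983, Ch. 9, Prop. 9.23] -/
theorem exists_isMetricFamilyOn_shift (hG : IsMetricOn G V) (hX : ContDiffOn ℝ ∞ X V)
    (hLG : ∀ y ∈ V, ∀ v w,
      fderiv ℝ G y (X y) v w + G y (fderiv ℝ X y v) w + G y v (fderiv ℝ X y w) = 0)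
    (hx : x ∈ V) :
    ∃ ρ ε : ℝ, 0 < ρ ∧ 0 < ε ∧ ball x ρ ⊆ V ∧
      (∀ t ∈ Icc (-ε) ε, IsCoordChangeOn (fun y ↦ y + t • X y) (ball x ρ) V) ∧
      IsMetricFamilyOn (fun t y ↦ pullMetric G (fun z ↦ z + t • X z) y) (Icc (-ε) ε) (ball x ρ) ∧
      ∀ y ∈ ball x ρ, tDeriv (fun t y ↦ pullMetric G (fun z ↦ z + t • X z) y) (Icc (-ε) ε) 0 y = 0 := by
  obtain ⟨ρ, ε, hρ, hε, hball, hcc⟩ := exists_isCoordChangeOn_shift hG.isOpen hX hx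
  have hεε : -ε < ε := by linarith
  have hfam : IsMetricFamilyOn (fun t y ↦ pullMetric G (fun z ↦ z + t • X z) y) (Icc (-ε) ε)
      (ball x ρ) :=
    { isMetricOn := fun t ht ↦ hG.isMetricOn_pullMetric (hcc t ht)
      contDiffOn := contDiffOn_pullMetric_shift hG hX hball fun t ht ↦ (hcc t ht).mapsTo
      uniqueDiffOn := uniqueDiffOn_Icc hεε
      subset_closure_interior := by rw [interior_Icc, closure_Ioo hεε.ne] }
  have h0 : (0 : ℝ) ∈ Icc (-ε) ε := ⟨by linarith, by linarith⟩
  refine ⟨ρ, ε, hρ, hε, hball, hcc, hfam, fun y hy ↦ ?_⟩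
  exact (hasDerivAt_pullMetric_shift hG hX (hball hy) (hLG y (hball hy))).hasDerivWithinAt.derivWithin
    (hfam.uniqueDiffOn 0 h0)

/-- **A Killing vector field preserves the square norm of the curvature**: if `𝓛_X G = 0` on `V`
then `X(|Rm|²_G) = 0` on `V`, i.e. `D(|Rm|²_G)_x(X x) = 0`. Infinitesimal form of O'Neill 1983,
Ch. 3, Prop. 3.59–Cor. 3.61 (curvature and its metric contractions are isometric invariants) with
Ch. 9, Prop. 9.23 (the local flow of a Killing field consists of isometries); proved here without
flows: `|Rm|²(ψ_t^*G)(x) = |Rm|²(G)(ψ_t x)` for the coordinate changes `ψ_t = id + tX`, and the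
left-hand side is stationary at `t = 0` because the first variation `𝓛_X G` of the family vanishes.
[cite: ONeill1983, Ch. 9, Prop. 9.23 and Ch. 3, Prop. 3.59] -/
theorem fderiv_rmNormSqAt_apply_eq_zero (hG : IsMetricOn G V) (hX : ContDiffOn ℝ ∞ X V)
    (hLG : ∀ y ∈ V, ∀ v w,
      fderiv ℝ G y (X y) v w + G y (fderiv ℝ X y v) w + G y v (fderiv ℝ X y w) = 0)
    (hx : x ∈ V) : fderiv ℝ (rmNormSqAt G) x (X x) = 0 := by
  obtain ⟨ρ, ε, hρ, hε, hball, hcc, hfam, hT⟩ := exists_isMetricFamilyOn_shift hG hX hLG hx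
  have h0 : (0 : ℝ) ∈ Icc (-ε) ε := ⟨by linarith, by linarith⟩
  have hxb : x ∈ ball x ρ := mem_ball_self hρ
  -- stationarity of `s ↦ |Rm|²(ψ_s^* G)(x)` and naturality
  have h1 := hfam.hasDerivWithinAt_rmNormSqAt_zero h0 hT hxb
  have h2 : HasDerivWithinAt (fun s : ℝ ↦ rmNormSqAt G (x + s • X x)) 0 (Icc (-ε) ε) 0 := by
    refine h1.congr (fun s hs ↦ ?_) ?_
    · exact (rmNormSqAt_pullMetric hG (hcc s hs) hxb).symm
    · simpa using (rmNormSqAt_pullMetric hG (hcc 0 h0) hxb).symm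
  have h3 : HasDerivAt (fun s : ℝ ↦ rmNormSqAt G (x + s • X x)) 0 0 :=
    h2.hasDerivAt (Icc_mem_nhds (by linarith) hε)
  -- the chain rule
  have hin : HasDerivAt (fun s : ℝ ↦ x + s • X x) (X x) 0 := by
    simpa using ((hasDerivAt_id (0 : ℝ)).smul_const (X x)).const_add x
  have hQ : HasFDerivAt (rmNormSqAt G) (fderiv ℝ (rmNormSqAt G) x) (x + (0 : ℝ) • X x) := by
    rw [zero_smul, add_zero]
    exact (((hG.contDiffOn_rmNormSqAt x hx).contDiffAt (hG.mem_nhds hx)).differentiableAt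
      (by simp)).hasFDerivAt
  have h4 : HasDerivAt (fun s : ℝ ↦ rmNormSqAt G (x + s • X x)) (fderiv ℝ (rmNormSqAt G) x (X x)) 0 := by
    have h := hQ.comp_hasDerivAt (0 : ℝ) hin
    rwa [Function.comp_def] at h
  exact h4.unique h3

/-- **A Killing vector field preserves the cubic trace invariant of the curvature**: if `𝓛_X G = 0`
on `V` then, in any basis `b`, the derivative along `X` of
`y ↦ Σ g^{aa'} g^{cc'} g^{ee'} tr(R(b_a,b_c) R(b_{c'},b_e) R(b_{e'},b_{a'}))(y)` vanishes on `V`.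
Same proof as `fderiv_rmNormSqAt_apply_eq_zero`, with the naturality `cubicTrace_pullMetric` and the
basis independence `cubicTrace_eq_of_basis`. [cite: ONeill1983, Ch. 9, Prop. 9.23 and Ch. 3, Prop. 3.59] -/
theorem fderiv_cubicTrace_apply_eq_zero {ι : Type*} [Fintype ι] [DecidableEq ι] (b : Basis ι ℝ E)
    (hG : IsMetricOn G V) (hX : ContDiffOn ℝ ∞ X V)
    (hLG : ∀ y ∈ V, ∀ v w,
      fderiv ℝ G y (X y) v w + G y (fderiv ℝ X y v) w + G y v (fderiv ℝ X y w) = 0)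
    (hx : x ∈ V) :
    fderiv ℝ (fun y ↦ ∑ a, ∑ a', ∑ c, ∑ c', ∑ e, ∑ e',
        ginv G b y a a' * ginv G b y c c' * ginv G b y e e' *
        traceCLM E ((riemAt G y (b a) (b c)).comp
          ((riemAt G y (b c') (b e)).comp (riemAt G y (b e') (b a'))))) x (X x) = 0 := by
  obtain ⟨ρ, ε, hρ, hε, hball, hcc, hfam, hT⟩ := exists_isMetricFamilyOn_shift hG hX hLG hx
  have h0 : (0 : ℝ) ∈ Icc (-ε) ε := ⟨by linarith, by linarith⟩
  have hxb : x ∈ ball x ρ := mem_ball_self hρ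
  set Q : E → ℝ := fun y ↦ ∑ a, ∑ a', ∑ c, ∑ c', ∑ e, ∑ e',
        ginv G b y a a' * ginv G b y c c' * ginv G b y e e' *
        traceCLM E ((riemAt G y (b a) (b c)).comp
          ((riemAt G y (b c') (b e)).comp (riemAt G y (b e') (b a')))) with hQdef
  -- naturality on the ball, in the fixed basis `b`
  have hnat : ∀ s ∈ Icc (-ε) ε, (∑ a, ∑ a', ∑ c, ∑ c', ∑ e, ∑ e',
        ginv (pullMetric G (fun z ↦ z + s • X z)) b x a a' *
        ginv (pullMetric G (fun z ↦ z + s • X z)) b x c c' *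
        ginv (pullMetric G (fun z ↦ z + s • X z)) b x e e' *
        traceCLM E ((riemAt (pullMetric G (fun z ↦ z + s • X z)) x (b a) (b c)).comp
          ((riemAt (pullMetric G (fun z ↦ z + s • X z)) x (b c') (b e)).comp
            (riemAt (pullMetric G (fun z ↦ z + s • X z)) x (b e') (b a'))))) = Q (x + s • X x) := by
    intro s hs
    obtain ⟨D, hD⟩ := (hcc s hs).isInvertible x hxb
    rw [cubicTrace_pullMetric b hG (hcc s hs) hxb hD, hQdef]
    exact (cubicTrace_eq_of_basis G b (b.map D.toLinearEquiv) (x + s • X x)).symm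
  have h1 := hfam.hasDerivWithinAt_cubicTrace_zero b h0 hT hxb
  have h2 : HasDerivWithinAt (fun s : ℝ ↦ Q (x + s • X x)) 0 (Icc (-ε) ε) 0 :=
    h1.congr (fun s hs ↦ (hnat s hs).symm) (by simpa using (hnat 0 h0).symm)
  have h3 : HasDerivAt (fun s : ℝ ↦ Q (x + s • X x)) 0 0 := h2.hasDerivAt (Icc_mem_nhds (by linarith) hε)
  have hin : HasDerivAt (fun s : ℝ ↦ x + s • X x) (X x) 0 := by
    simpa using ((hasDerivAt_id (0 : ℝ)).smul_const (X x)).const_add x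
  have hQd : HasFDerivAt Q (fderiv ℝ Q x) (x + (0 : ℝ) • X x) := by
    rw [zero_smul, add_zero]
    exact (((contDiffOn_cubicTrace' b hG x hx).contDiffAt (hG.mem_nhds hx)).differentiableAt
      (by simp)).hasFDerivAt
  have h4 : HasDerivAt (fun s : ℝ ↦ Q (x + s • X x)) (fderiv ℝ Q x (X x)) 0 := by
    have h := hQd.comp_hasDerivAt (0 : ℝ) hin
    rwa [Function.comp_def] at h
  exact h4.unique h3

end Family

end MetricCoord

end Literature.Geometry.Lorentzian

end
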